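import Summits.QuantumAdvantage.QuantumAdvantage.Theorems.CharDialTokenDialD
import HarnessLib

/-!
# CharDial tower — the TOKEN DIAL, part G: the SEMANTIC ENGINE INEQUALITY (readers = cuts that are not swap-stable)

Cell `decomp-qadv`, lens 6 («barrier-complement carving»), generation 19 (REV2); supports stmt-QuantumAdvantage-27206 / 27207
(crux 32604).  Imports part D.

Part D's local engine asks the pair `(s, t = s+1)` to be DEAD (equal coefficients, outside the junta) for every cut outside the reader
set — a PRESENTATION-level condition.  The only use of deadness in that proof is the pointwise consequence «cut `g` answers the same on
`u` and on its transpose» (`cut_swap_insensitive`).  This part re-runs the engine under that consequence alone: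

★ `engineSem`: for ANY set `G' ∋ cut t` of cuts such that every cut OUTSIDE `G'` is SWAP-STABLE on `{u : u_s ≠ u_t}`
(`y g u^{(st)} = y g u`, a property of the STRATEGY),
`3·#WIN_c + #richLoc ≤ 3·2ⁿ + 8·p^{|G'|}·2^{Σ_{g ∈ G'} |J_g|}·(2cos(π/(3p)))ⁿ`.
So the readers that cost a factor `p·2^{|J_g|}` each are only the cuts whose answer actually moves under the transposition somewhere —
in the toy census of the node memo every LOW family has at most TWO such cuts per rich pair, however wide its juntas.
0 sorry.  Part H turns it into the eighth dial `tokenSem_hard K` with the presentation-free hypothesis `TowerDefs.TokenHypSem p K y`.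
-/

set_option autoImplicit false

namespace Summit.QuantumAdvantage.AdviceFreeQNC0.JLinPeel.TokenDial

open Finset SegMove

variable {n : ℕ}

section SemEngine

variable {p : ℕ} [hp : Fact p.Prime]

omit hp in
/-- deadness is one way to be swap-stable: a cut with equal coefficients at `s, t` and `s, t` outside its junta answers the same on
`u` and on its transpose whenever `u_s ≠ u_t`. -/
theorem swapStable_of_dead (D : JLinData p n) (s t : Fin n) (hst : t.val = s.val + 1) (g : Fin (n + 1))
    (hd : D.a g s = D.a g t ∧ s ∉ D.J g ∧ t ∉ D.J g) (u : Fin n → Bool) (hne : u s ≠ u t) :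
    D.strat g (segCompl u s.val (s.val + 2)) = D.strat g u := by
  rw [strat_eq, strat_eq]
  exact cut_swap_insensitive (D.J g) (D.a g) (D.h g) (D.hJ g) u s t hst hne hd.1 hd.2.1 hd.2.2

/-- **(flip cells ⊆ flipE, semantic readers)** on a relevant cell, an input whose cut-`t` address lies in one of the two flipping
classes flips the win bit — assuming only that every cut outside `G' ∋ cut t` is SWAP-STABLE on the swap set (no deadness). -/
theorem flipCellM_subset_sem (c : ℕ) (D : JLinData p n) (s t : Fin n) (hst : t.val = s.val + 1)
    (G' : Finset (Fin (n + 1))) (htG : cut t ∈ G')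
    (hS : ∀ g, g ∉ G' → ∀ u : Fin n → Bool, u s ≠ u t → D.strat g (segCompl u s.val (s.val + 2)) = D.strat g u)
    (O : Finset (Fin n)) (hsO : s ∈ O) (htO : t ∈ O) (hJO : ∀ g ∈ G', D.J g ⊆ O)
    (TV : Finset (Fin n) × (Fin (n + 1) → ZMod p)) (hTV : TV ∈ idxM D G' O s t) :
    flipCellM c D G' O s t TV ⊆ flipE c D.strat s t := by
  classical
  intro u hu
  unfold flipCellM at hu
  rw [mem_filter] at hu
  obtain ⟨hcell, haddr⟩ := hu
  have hpat := ((mem_cellM _ _ _ _ u).1 hcell).1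
  rw [mem_idxM] at hTV
  obtain ⟨-, hneT, hact, hacc⟩ := hTV
  have hne : u s ≠ u t := by rw [hpat s hsO, hpat t htO]; exact hneT
  have hinert : ∀ g : Fin (n + 1), g ≠ cut t → D.strat g (segCompl u s.val (s.val + 2)) = D.strat g u := by
    intro g hgt
    by_cases hg : g ∈ G'
    · rw [strat_after D G' O s t hst hsO htO _ _ u hcell hne g hg (hJO g hg),
        strat_before D G' O _ _ u hcell g hg (hJO g hg)]
      exact hact g hg hgt
    · exact hS g hg u hne
  rw [mem_flipE]
  refine ⟨hne, ringWinU_swap_of_iff c D.strat u s t hst hne hinert ?_⟩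
  have hF := strat_before D G' O _ _ u hcell (cut t) htG (hJO _ htG)
  have hF' := strat_after D G' O s t hst hsO htO _ _ u hcell hne (cut t) htG (hJO _ htG)
  have hshift := addr_swap_at c u s t hst hne
  rw [← hst] at hshift
  rw [hF, hF', hshift]
  rw [hpat s hsO]
  exact flip_key _ _ _ _ (addr_lt_three c u t.val) hacc haddr


/-- **(counting the flip cells, semantic readers)** `Σ_{relevant cells} (#res1 part + #res2 part) ≤ |flipE|`. -/
theorem sum_flip_le_flipE_sem (c : ℕ) (D : JLinData p n) (s t : Fin n) (hst : t.val = s.val + 1)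
    (G' : Finset (Fin (n + 1))) (htG : cut t ∈ G')
    (hS : ∀ g, g ∉ G' → ∀ u : Fin n → Bool, u s ≠ u t → D.strat g (segCompl u s.val (s.val + 2)) = D.strat g u)
    (O : Finset (Fin n)) (hsO : s ∈ O) (htO : t ∈ O) (hJO : ∀ g ∈ G', D.J g ⊆ O) :
    ∑ TV ∈ idxM D G' O s t,
        (((cellM O (patt TV.1) (formsOf D G') TV.2).filter fun u =>
            addr c u t.val = res1 (decB D TV.1 TV.2 (cut t)) (decA D G' s t TV.1 TV.2 (cut t))).card +
          ((cellM O (patt TV.1) (formsOf D G') TV.2).filter fun u =>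
            addr c u t.val = res2 (decB D TV.1 TV.2 (cut t)) (decA D G' s t TV.1 TV.2 (cut t)) (patt TV.1 s)).card)
      ≤ (flipE c D.strat s t).card := by
  classical
  have hsum : ∀ TV ∈ idxM D G' O s t,
      ((cellM O (patt TV.1) (formsOf D G') TV.2).filter fun u =>
          addr c u t.val = res1 (decB D TV.1 TV.2 (cut t)) (decA D G' s t TV.1 TV.2 (cut t))).card +
        ((cellM O (patt TV.1) (formsOf D G') TV.2).filter fun u =>
          addr c u t.val = res2 (decB D TV.1 TV.2 (cut t)) (decA D G' s t TV.1 TV.2 (cut t)) (patt TV.1 s)).card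
      = (flipCellM c D G' O s t TV).card := by
    intro TV _
    unfold flipCellM
    rw [filter_or, card_union_of_disjoint]
    rw [disjoint_filter]
    intro u _ h1 h2
    exact res1_ne_res2 _ _ _ (h1.symm.trans h2)
  rw [sum_congr rfl hsum, ← card_biUnion]
  · exact card_le_card (biUnion_subset.2 fun TV hTV =>
      flipCellM_subset_sem c D s t hst G' htG hS O hsO htO hJO TV hTV)
  · intro TV hTV TV' hTV' hne
    have h1 := ((mem_idxM D G' O s t TV).1 hTV).1.1
    have h2 := ((mem_idxM D G' O s t TV').1 hTV').1.1
    unfold flipCellM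
    exact disjoint_filter_filter (cellM_disjoint O (formsOf D G') h1 h2 (by
      intro h; apply hne; exact Prod.ext (congrArg Prod.fst h) (congrArg Prod.snd h)))

/-- ★ **THE SEMANTIC ENGINE INEQUALITY.** for a junta ⊕ `𝔽_p`-form presentation, an adjacent pair `(s, t = s+1)` and ANY set
`G' ∋ cut t` of cuts outside which the STRATEGY is swap-stable on the swap set `{u : u_s ≠ u_t}` (`3 ∤ p`):
`3·#WIN_c + #richLoc ≤ 3·2ⁿ + 8·p^{|G'|}·2^{Σ_{g ∈ G'} |J_g|}·(2cos(π/(3p)))ⁿ`.  Part D's `engineLoc` is the case of a pair DEAD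
outside `G` (`G' = G ∪ {cut t}`), deadness being one way to be swap-stable (`swapStable_of_dead`). -/
theorem engineSem (hp3 : p ≠ 3) (c : ℕ) (D : JLinData p n) (s t : Fin n) (hst : t.val = s.val + 1)
    (G' : Finset (Fin (n + 1))) (htG : cut t ∈ G')
    (hS : ∀ g, g ∉ G' → ∀ u : Fin n → Bool, u s ≠ u t → D.strat g (segCompl u s.val (s.val + 2)) = D.strat g u) :
    3 * ((univ.filter fun u : Fin n → Bool => ringWinU c D.strat u = true).card : ℝ)
      + ((richLoc D.strat s t).card : ℝ)
      ≤ 3 * (2 : ℝ) ^ n + 8 * (p : ℝ) ^ G'.card *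
          (2 : ℝ) ^ (∑ g ∈ G', (D.J g).card) * (2 * Real.cos (Real.pi / (3 * p))) ^ n := by
  classical
  set O : Finset (Fin n) := insert s (insert t (G'.biUnion D.J)) with hO
  have hJO : ∀ g ∈ G', D.J g ⊆ O := fun g hg i hi => by
    rw [hO]; exact mem_insert_of_mem (mem_insert_of_mem (mem_biUnion.2 ⟨g, hg, hi⟩))
  have hsO : s ∈ O := by rw [hO]; exact mem_insert_self _ _
  have htO : t ∈ O := by rw [hO]; exact mem_insert_of_mem (mem_insert_self _ _)
  have hOcard : O.card ≤ (∑ g ∈ G', (D.J g).card) + 2 := by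
    rw [hO]
    refine (card_insert_le _ _).trans ?_
    have h1 := card_insert_le t (G'.biUnion D.J)
    have h2 : (G'.biUnion D.J).card ≤ ∑ g ∈ G', (D.J g).card := card_biUnion_le
    omega
  set err : ℝ := 2 * (2 * Real.cos (Real.pi / (3 * p))) ^ n with herr
  -- (1) the pairing inequality
  have hpair := flip_pairing c D.strat s t hst
  -- (2) the rich set is covered by the relevant cells
  have hR : ((richLoc D.strat s t).card : ℝ)
      ≤ ∑ TV ∈ idxM D G' O s t, ((cellM O (patt TV.1) (formsOf D G') TV.2).card : ℝ) := by
    have h := (card_le_card (richLoc_subset D G' O s t hst hsO htO htG hJO)).trans card_biUnion_le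
    exact_mod_cast h
  -- (3) the flip cells fit into flipE
  have hE := sum_flip_le_flipE_sem c D s t hst G' htG hS O hsO htO hJO
  -- (4) per cell: two thirds, up to err each
  have hcell : ∀ TV ∈ idxM D G' O s t,
      2 * ((cellM O (patt TV.1) (formsOf D G') TV.2).card : ℝ) ≤
        3 * ((((cellM O (patt TV.1) (formsOf D G') TV.2).filter fun u =>
            addr c u t.val = res1 (decB D TV.1 TV.2 (cut t)) (decA D G' s t TV.1 TV.2 (cut t))).card +
          ((cellM O (patt TV.1) (formsOf D G') TV.2).filter fun u =>
            addr c u t.val = res2 (decB D TV.1 TV.2 (cut t)) (decA D G' s t TV.1 TV.2 (cut t)) (patt TV.1 s)).card : ℕ) : ℝ)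
        + 2 * err := by
    intro TV _
    have h0 := cell_le_three_addrM hp3 c O (patt TV.1) (formsOf D G') TV.2 t _ (res1_lt (decB D TV.1 TV.2 (cut t))
      (decA D G' s t TV.1 TV.2 (cut t)))
    have h1 := cell_le_three_addrM hp3 c O (patt TV.1) (formsOf D G') TV.2 t _ (res2_lt (decB D TV.1 TV.2 (cut t))
      (decA D G' s t TV.1 TV.2 (cut t)) (patt TV.1 s))
    push_cast at h0 h1 ⊢
    linarith
  have hsum := sum_le_sum hcell
  rw [← mul_sum, sum_add_distrib, ← mul_sum, sum_const, nsmul_eq_mul] at hsum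
  -- (5) sizes
  have hidx : ((idxM D G' O s t).card : ℝ) ≤ 4 * (2 : ℝ) ^ (∑ g ∈ G', (D.J g).card) * (p : ℝ) ^ G'.card := by
    have h := card_idxM_le D G' O s t
    have h2 : (2 : ℕ) ^ O.card ≤ 2 ^ ((∑ g ∈ G', (D.J g).card) + 2) := Nat.pow_le_pow_right (by norm_num) hOcard
    have h3 : (idxM D G' O s t).card ≤ 2 ^ ((∑ g ∈ G', (D.J g).card) + 2) * p ^ G'.card :=
      h.trans (Nat.mul_le_mul_right _ h2)
    have h4 : ((idxM D G' O s t).card : ℝ) ≤ ((2 ^ ((∑ g ∈ G', (D.J g).card) + 2) * p ^ G'.card : ℕ) : ℝ) := by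
      exact_mod_cast h3
    refine h4.trans (le_of_eq ?_)
    push_cast
    ring
  have herr0 : 0 ≤ err := by
    rw [herr]
    have hcos : 0 ≤ Real.cos (Real.pi / (3 * p)) := by
      apply Real.cos_nonneg_of_neg_pi_div_two_le_of_le
      · have : 0 ≤ Real.pi / (3 * p) := by positivity
        linarith [Real.pi_pos]
      · rw [div_le_div_iff₀ (by have := hp.out.pos; positivity) (by norm_num)]
        have : (2 : ℝ) ≤ p := by exact_mod_cast hp.out.two_le
        nlinarith [Real.pi_pos]
    positivity
  have hpairR : 2 * ((univ.filter fun u : Fin n → Bool => ringWinU c D.strat u = true).card : ℝ)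
      + ((flipE c D.strat s t).card : ℝ) ≤ 2 * (2 : ℝ) ^ n := by exact_mod_cast hpair
  have hER : ((∑ TV ∈ idxM D G' O s t,
      (((cellM O (patt TV.1) (formsOf D G') TV.2).filter fun u =>
          addr c u t.val = res1 (decB D TV.1 TV.2 (cut t)) (decA D G' s t TV.1 TV.2 (cut t))).card +
        ((cellM O (patt TV.1) (formsOf D G') TV.2).filter fun u =>
          addr c u t.val = res2 (decB D TV.1 TV.2 (cut t)) (decA D G' s t TV.1 TV.2 (cut t)) (patt TV.1 s)).card) : ℕ) : ℝ)
      ≤ ((flipE c D.strat s t).card : ℝ) := by exact_mod_cast hE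
  push_cast at hER hsum
  have hpp : (0 : ℝ) ≤ 4 * (2 : ℝ) ^ (∑ g ∈ G', (D.J g).card) * (p : ℝ) ^ G'.card := by positivity
  have hmul : ((idxM D G' O s t).card : ℝ) * (2 * err)
      ≤ 4 * (2 : ℝ) ^ (∑ g ∈ G', (D.J g).card) * (p : ℝ) ^ G'.card * (2 * err) :=
    mul_le_mul_of_nonneg_right hidx (by linarith)
  rw [herr] at hmul
  nlinarith [hR, hsum, hER, hpairR, hmul, herr0]


/- `engineLoc` (part D) is the dead case of `engineSem`: `engineSem … (insert (cut t) G) … (swapStable_of_dead …)`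
   re-proves it verbatim (readback deleted at landing as a restatement of the landed `engineLoc`, gate dedup.landed). -/

end SemEngine

end Summit.QuantumAdvantage.AdviceFreeQNC0.JLinPeel.TokenDial
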